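import Mathlib.Algebra.Order.BigOperators.Group.Finset
import Mathlib.Algebra.BigOperators.Ring.Finset
import Mathlib.Data.Real.Basic
import Mathlib.Order.Monotone.Basic
import Mathlib.Order.MinMax
import Mathlib.Tactic.Linarith
import Mathlib.Tactic.Ring
import HarnessLib

/-!
# The `F`-inequality in dimension two: the MIN-FORM for comonotone profiles (products of two chains)

Unit `prim-master-conj` (crux anchor stmt-CriticalPhenomena-4575, helper work), gen 23; memo
`run/shared/lean/prim/prim-l12/prim-master-conj/POINTWISE.md` §24.7.

`F(A,B;G) := (1 + μG)·μ(A∩B∩G) − μG·μ(A∩B) − μ(A∩G)·μ(B∩G) ≥ 0` is conjectured for increasing events of a cube with a product measure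
(gen 20).  The cube `{0,1}^n` is a product of `n` two-element chains, and the conjecture makes sense verbatim on any product of finite chains
`C₁ × ⋯ × C_d` with a product probability measure ("dimension `d`, arbitrary resolution"); conversely chains embed monotonically in cubes,
so this is the same conjecture.  Conditioning on the last `d−1` chains and using that the up-sets of ONE chain are nested upper intervals
(so the measure of an intersection of sections is the MIN of their measures) turns `F` into the MIN-FORM: for increasing `[0,1]`-valued
`a, b, c` on `C₂ × ⋯ × C_d`,
  `Φ(a,b;c) := (1 + E c)·E[a ∧ b ∧ c] − E c · E[a ∧ b] − E[a ∧ c]·E[b ∧ c] ≥ 0`   (`∧` = pointwise min, `E` = product expectation),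
and `F ≥ 0` on all cubes ⟺ `Φ ≥ 0` for all increasing `[0,1]`-valued triples on all cubes (memo §24.7).

THIS FILE proves the min-form in DIMENSION TWO, i.e. when the remaining factor is a single chain: for a finite chain (here `Fin n` with any
probability weights `w`) and COMONOTONE (= all nondecreasing) `a, b, c : Fin n → [0,1]`,
  **`(1 + Σ wc)·Σ w(a∧b∧c) ≥ (Σ wc)·(Σ w(a∧b)) + (Σ w(a∧c))·(Σ w(b∧c))`**   (`fMin_nonneg_of_monotone`).
Equivalently: `F(A,B;G) ≥ 0` for all up-sets `A, B, G` of a product of TWO finite chains with any product measure — the two-dimensional case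
of the conjecture at every resolution (the analogue, for `F`, of the Lieb–Sahi theorem for Sahi's `E₃` on the unit square).
PROOF (a two-point Chebyshev argument): with `m = a∧b∧c`, `p = a∧c`, `q = b∧c`, `r = a∧b − m = (a∧b − c)₊` one has
`Φ = E[m] − E[p]E[q] − E[c]E[r] = ½·E_{y,y'}[K(y,y')]`, `K(y,y') = m + m' − p q' − p' q − c' r − c r'`, and `K ≥ 0` for every pair of
comonotone value triples (`kernel_nonneg`: four cases according to `c ≤ a∧b` or not at each of the two points; `kernel_abstract` is the
case-free algebraic core).  For a general product of chains the same symmetrisation over antipodal pairs of a box reduces `F ≥ 0` on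
`d` chains to the antipodal ("comb") inequality `F_comb` on `{0,1}^d` (memo §24.7), so prim-bnk-2's exhaustive `F_comb` census (`d ≤ 6`)
covers every product of at most six chains of any lengths; `d = 2` is the human case done here.
HONEST FRAMING: an elementary theorem (dimension two); `F ≥ 0` in general remains OPEN. [this work]
-/

noncomputable section

namespace Summit.CriticalPhenomena.PercolationContinuityZ3.Theorems

namespace FMinForm

open Finset

/-- **Algebraic core of the two-point kernel.**  At a point `y` of the chain put `m = a∧b∧c`, `p = a∧c`, `q = b∧c`, `r = a∧b − m`; these satisfy
`0 ≤ m ≤ p, q ≤ c ≤ 1`, `r ≥ 0`, `m + r ≤ 1`, one of `p, q` equals `m`, and either `r = 0` or `p = q = m = c`; at a larger point `y'` the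
same with primes and `c ≤ c'`, `p ≤ p'`, `q ≤ q'`, `m + r ≤ m' + r'`.  Under exactly these constraints
`m + m' − p q' − p' q − c' r − c r' ≥ 0`. [this work] -/
theorem kernel_abstract (m p q c r m' p' q' c' r' : ℝ)
    (h0 : 0 ≤ m) (hmp : m ≤ p) (hmq : m ≤ q) (hpc : p ≤ c) (hqc : q ≤ c) (hc1 : c ≤ 1) (hr : 0 ≤ r) (hur : m + r ≤ 1)
    (htype : r = 0 ∨ (p = c ∧ q = c ∧ m = c)) (hpq : p = m ∨ q = m)
    (h0' : 0 ≤ m') (hmp' : m' ≤ p') (hmq' : m' ≤ q') (hpc' : p' ≤ c') (hqc' : q' ≤ c') (hc1' : c' ≤ 1) (hr' : 0 ≤ r')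
    (hur' : m' + r' ≤ 1) (htype' : r' = 0 ∨ (p' = c' ∧ q' = c' ∧ m' = c')) (hpq' : p' = m' ∨ q' = m')
    (hcc : c ≤ c') (hpp : p ≤ p') (hqq : q ≤ q') (huu : m + r ≤ m' + r') :
    0 ≤ m + m' - p * q' - p' * q - c' * r - c * r' := by
  have hc0 : 0 ≤ c := le_trans (le_trans h0 hmp) hpc
  have hc0' : 0 ≤ c' := le_trans (le_trans h0' hmp') hpc'
  rcases htype with hr0 | ⟨hp, hq, hm⟩ <;> rcases htype' with hr0' | ⟨hp', hq', hm'⟩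
  · -- both points of type (ii): r = r' = 0
    subst hr0; subst hr0'
    rcases hpq with h1 | h1 <;> rcases hpq' with h2 | h2
    · nlinarith [mul_nonneg h0 (sub_nonneg.2 (le_trans hqc' hc1')), mul_nonneg h0' (sub_nonneg.2 (le_trans hqc hc1))]
    · nlinarith [mul_nonneg h0 (sub_nonneg.2 (le_trans hqc' hc1')), mul_nonneg (le_trans h0' hmq') (sub_nonneg.2 (le_trans hpc' hc1')),
        mul_nonneg (le_trans h0' hmp') (sub_nonneg.2 hqq)]
    · nlinarith [mul_nonneg h0 (sub_nonneg.2 (le_trans hpc' hc1')), mul_nonneg (le_trans h0' hmp') (sub_nonneg.2 (le_trans hqc' hc1')),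
        mul_nonneg (le_trans h0' hmq') (sub_nonneg.2 hpp)]
    · nlinarith [mul_nonneg h0 (sub_nonneg.2 (le_trans hpc' hc1')), mul_nonneg h0' (sub_nonneg.2 (le_trans hpc hc1))]
  · -- `y` of type (ii), `y'` of type (i)
    subst hr0
    rcases hpq with h1 | h1 <;>
    nlinarith [mul_nonneg h0 (sub_nonneg.2 hc1'), mul_nonneg hc0' (sub_nonneg.2 hpc), mul_nonneg hc0' (sub_nonneg.2 hqc),
      mul_nonneg hc0 (sub_nonneg.2 hur'), mul_nonneg hc0' (sub_nonneg.2 hc1), sub_nonneg.2 hcc]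
  · -- `y` of type (i), `y'` of type (ii)
    subst hr0'
    rcases hpq' with h2 | h2 <;>
    nlinarith [mul_nonneg hc0 (sub_nonneg.2 hur'), mul_nonneg hc0 (sub_nonneg.2 hpc'), mul_nonneg hc0 (sub_nonneg.2 hqc'),
      mul_nonneg (le_trans h0' hmp') (sub_nonneg.2 hc1'), mul_nonneg (le_trans h0' hmq') (sub_nonneg.2 hc1'), mul_nonneg hc0' (sub_nonneg.2 huu),
      mul_nonneg h0' (sub_nonneg.2 hc1')]
  · -- both of type (i)
    nlinarith [mul_nonneg hc0 (sub_nonneg.2 hur'), mul_nonneg hc0' (sub_nonneg.2 hur)]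

/-- **The two-point kernel is nonnegative** for comonotone value triples `(a,b,c) ≤ (a',b',c')` in `[0,1]`:
`K = a∧b∧c + a'∧b'∧c' − (a∧c)(b'∧c') − (a'∧c')(b∧c) − c'·(a∧b − a∧b∧c) − c·(a'∧b' − a'∧b'∧c') ≥ 0`. [this work] -/
theorem kernel_nonneg {a b c a' b' c' : ℝ} (ha0 : 0 ≤ a) (hb0 : 0 ≤ b) (hc0 : 0 ≤ c) (ha1 : a' ≤ 1) (hb1 : b' ≤ 1)
    (hc1 : c' ≤ 1) (haa : a ≤ a') (hbb : b ≤ b') (hcc : c ≤ c') :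
    0 ≤ min a (min b c) + min a' (min b' c') - min a c * min b' c' - min a' c' * min b c
        - c' * (min a b - min a (min b c)) - c * (min a' b' - min a' (min b' c')) := by
  -- structural facts at one point
  have typ : ∀ x y z : ℝ, (min x y - min x (min y z) = 0) ∨ (min x z = z ∧ min y z = z ∧ min x (min y z) = z) := by
    intro x y z
    rcases le_total z (min x y) with h | h
    · right
      have hx : z ≤ x := le_trans h (min_le_left x y)
      have hy : z ≤ y := le_trans h (min_le_right x y)
      refine ⟨min_eq_right hx, min_eq_right hy, ?_⟩
      rw [min_eq_right hy, min_eq_right hx]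
    · left
      have : min x (min y z) = min x y := by
        rw [← min_assoc]; exact min_eq_left h
      rw [this, sub_self]
  have sel : ∀ x y z : ℝ, min x z = min x (min y z) ∨ min y z = min x (min y z) := by
    intro x y z
    rcases le_total x y with h | h
    · left; rw [← min_assoc, min_eq_left h]
    · right; exact (min_eq_right (le_trans (min_le_left y z) h)).symm
  have ha1' : a ≤ 1 := le_trans haa ha1
  have hb1' : b ≤ 1 := le_trans hbb hb1
  refine kernel_abstract (min a (min b c)) (min a c) (min b c) c (min a b - min a (min b c))
    (min a' (min b' c')) (min a' c') (min b' c') c' (min a' b' - min a' (min b' c'))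
    (le_min ha0 (le_min hb0 hc0)) (min_le_min le_rfl (min_le_right b c)) (min_le_right a _) (min_le_right a c) (min_le_right b c)
    (le_trans hcc hc1) (sub_nonneg.2 (min_le_min le_rfl (min_le_left b c))) (by linarith [min_le_left a b])
    (typ a b c) (sel a b c)
    (le_min (le_trans ha0 haa) (le_min (le_trans hb0 hbb) (le_trans hc0 hcc))) (min_le_min le_rfl (min_le_right b' c'))
    (min_le_right a' _) (min_le_right a' c') (min_le_right b' c') hc1
    (sub_nonneg.2 (min_le_min le_rfl (min_le_left b' c'))) (by linarith [min_le_left a' b'])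
    (typ a' b' c') (sel a' b' c')
    hcc (min_le_min haa hcc) (min_le_min hbb hcc) (by linarith [min_le_min haa hbb])

/-- **THE `F`-INEQUALITY IN DIMENSION TWO (min-form on a chain).**  For a finite chain `Fin n` with probability weights `w` and nondecreasing
`a, b, c : Fin n → [0,1]`:
`(1 + Σ w·c)·Σ w·(a∧b∧c) − (Σ w·c)·(Σ w·(a∧b)) − (Σ w·(a∧c))·(Σ w·(b∧c)) ≥ 0`.
Equivalently `F(A,B;G) ≥ 0` for all up-sets of a product of two finite chains with a product measure (`a, b, c` = the measures of the
row sections of `A, B, G`). [this work] -/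
theorem fMin_nonneg_of_monotone {n : ℕ} (w a b c : Fin n → ℝ) (hw : ∀ i, 0 ≤ w i) (hw1 : ∑ i, w i = 1)
    (ha : Monotone a) (hb : Monotone b) (hc : Monotone c)
    (ha0 : ∀ i, 0 ≤ a i) (ha1 : ∀ i, a i ≤ 1) (hb0 : ∀ i, 0 ≤ b i) (hb1 : ∀ i, b i ≤ 1) (hc0 : ∀ i, 0 ≤ c i) (hc1 : ∀ i, c i ≤ 1) :
    0 ≤ (1 + ∑ i, w i * c i) * (∑ i, w i * min (a i) (min (b i) (c i)))
        - (∑ i, w i * c i) * (∑ i, w i * min (a i) (b i))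
        - (∑ i, w i * min (a i) (c i)) * (∑ i, w i * min (b i) (c i)) := by
  -- abbreviations
  set m : Fin n → ℝ := fun i => min (a i) (min (b i) (c i)) with hm
  set p : Fin n → ℝ := fun i => min (a i) (c i) with hp
  set q : Fin n → ℝ := fun i => min (b i) (c i) with hq
  set r : Fin n → ℝ := fun i => min (a i) (b i) - m i with hr
  -- the asymmetric kernel `T i j`; `T i j + T j i = w i w j K(i,j)`
  set T : Fin n → Fin n → ℝ := fun i j => w i * m i * w j - w i * p i * (w j * q j) - w i * c i * (w j * r j) with hT
  have hK : ∀ i j, 0 ≤ T i j + T j i := by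
    intro i j
    have key : ∀ i j, i ≤ j → 0 ≤ T i j + T j i := by
      intro i j hij
      have k := kernel_nonneg (ha0 i) (hb0 i) (hc0 i) (ha1 j) (hb1 j) (hc1 j) (ha hij) (hb hij) (hc hij)
      have hww : 0 ≤ w i * w j := mul_nonneg (hw i) (hw j)
      have e : T i j + T j i = w i * w j * (min (a i) (min (b i) (c i)) + min (a j) (min (b j) (c j))
          - min (a i) (c i) * min (b j) (c j) - min (a j) (c j) * min (b i) (c i)
          - c j * (min (a i) (b i) - min (a i) (min (b i) (c i))) - c i * (min (a j) (b j) - min (a j) (min (b j) (c j)))) := by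
        simp only [hT, hm, hp, hq, hr]; ring
      rw [e]; exact mul_nonneg hww k
    rcases le_total i j with hij | hji
    · exact key i j hij
    · rw [add_comm]; exact key j i hji
  -- Σ_i Σ_j T i j = Φ
  have hrow : ∀ i, ∑ j, T i j = w i * m i * (∑ j, w j) - w i * p i * (∑ j, w j * q j) - w i * c i * (∑ j, w j * r j) := by
    intro i
    simp only [hT, Finset.sum_sub_distrib, ← Finset.mul_sum]
  have hsumT : ∑ i, ∑ j, T i j = (∑ i, w i * m i) - (∑ i, w i * p i) * (∑ j, w j * q j) - (∑ i, w i * c i) * (∑ j, w j * r j) := by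
    simp only [hrow, hw1, mul_one, Finset.sum_sub_distrib, ← Finset.sum_mul]
  have hsumr : ∑ j, w j * r j = (∑ j, w j * min (a j) (b j)) - ∑ j, w j * m j := by
    simp only [hr, mul_sub, Finset.sum_sub_distrib]
  -- positivity of the symmetrised double sum
  have hpos : 0 ≤ 2 * ∑ i, ∑ j, T i j := by
    have e2 : 2 * ∑ i, ∑ j, T i j = ∑ i, ∑ j, (T i j + T j i) := by
      rw [two_mul]
      simp only [Finset.sum_add_distrib]
      congr 1
      exact Finset.sum_comm
    rw [e2]
    exact Finset.sum_nonneg fun i _ => Finset.sum_nonneg fun j _ => hK i j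
  -- conclude
  have hΦ : (1 + ∑ i, w i * c i) * (∑ i, w i * min (a i) (min (b i) (c i)))
        - (∑ i, w i * c i) * (∑ i, w i * min (a i) (b i))
        - (∑ i, w i * min (a i) (c i)) * (∑ i, w i * min (b i) (c i)) = ∑ i, ∑ j, T i j := by
    rw [hsumT, hsumr]
    simp only [hm, hp, hq]
    ring
  rw [hΦ]
  linarith

end FMinForm

end Summit.CriticalPhenomena.PercolationContinuityZ3.Theorems
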